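/-
search for candidate a priori estimates; no regularity claim

# K85a — (R31, algebra) THE ACCELERATION OF A RULING FIELD IS A RULING DIRECTION: the pointwise
# linear algebra (any dimension, then `Fin 3`)

Node of record (verbatim, unchanged): L-λ(q) =
`Summit.NavierStokesRegularity.FunctionalMining.TopEigHeatCoercivePos q := ∃ c > 0,`
`TopEigHeatCoercive q c` — OPEN for every real `q > 1`; (F2) killing family WANTED/OPEN. This
file decides NOTHING about the node: door (e) box, pure algebra over `ℝ`, no field, no torus.
DATA at a point (K83b/K84 dictionary): a unit axis `u` (`∑ uᵢ² = 1`), a vector `K` (the value of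
a ruling field), the first jet `c_{k,i}`, the matrix `D_{m,l}` (`= ∂ₘK_l`), the contracted
second jet `N_{m,i}` (`= ∑ₖ K_k e_{km,i}`); the acceleration is `w_l := ∑ₘ K_m D_{m,l}` and
`E_i := ∑ₘ K_m N_{m,i}`. HYPOTHESES (all produced at a point by K85b from a ruling field of the
axis projector of an everywhere-biaxial field): `u·K = 0`, `∑ₖ K_k c_{k,i} = 0`, `u·c_k = 0`,
twist-freeness `c_{k,l} − a_l u_k = c_{l,k} − a_k u_l` (K83c), (D1) `u·D_m + K·c_m = 0`,
(D2) `∑ₖ D_{m,k} c_{k,i} + N_{m,i} = 0`, and on `Fin 3` the twist derivative (D3)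
`u₀(N₁₂ − N₂₁) + u₁(N₂₀ − N₀₂) + u₂(N₀₁ − N₁₀) = 0`. THEOREM `acc_is_ruling`: then `u·w = 0` and
`∑ₗ c_{l,i} w_l = 0` for every `i` — the acceleration satisfies the two (linearised) ruling
equations. MECHANISM: `∑ₗ c_{l,i} w_l = −E_i` (D2); `E·u = 0` (`u·c_k = 0`); `K·N_m = u_m(K·a)²`
(twist-free, (D1), (D2)) so `E·K = (K·a)²(u·K) = 0`; `E·(u × K) = 0` by (D3) and the axial
identity `N(K,u×K) − N(u×K,K) = |K|²·(u·ax N) − (u·K)·(K·ax N)`; the reciprocal basis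
`{u, K, u × K}` then gives `|K|² E = 0` (two explicit polynomial certificates), and `K = 0` is
trivial. HONEST PLACEMENT: Mathlib only (`Finset` sums, `linear_combination`). [ours] No number
of record moves (KERNEL `0.68261 ≤ C_lam ≤ 49/50` etc. untouched); no 𝒦₀ row. NOT CLAIMED:
anything about fields, rulings or the node — see K85b `NoGo.TopEigHeatRulingGeodesic`.
FILING (prove seat g34, REQUEST #118): declarations byte-identical to the no-go seat's staged `TopEigHeatRulingAlgebra.STAGING.lean` 5b80961c0bf04804; this line is the only addition.
-/
import Summits.NavierStokesRegularity.FunctionalMining.BiaxialSaintVenant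
import HarnessLib

noncomputable section

namespace Summit.NavierStokesRegularity.FunctionalMining

namespace TopEig.Ruling

/-! ## 1. Any dimension -/

section Algebra

variable {d : Type*} [Fintype d]

/-- `∑ᵢ aᵢ ∑ₘ bₘ N_{m,i} = ∑ₘ bₘ ∑ᵢ aᵢ N_{m,i}`. [bookkeeping] -/
theorem sum_swap3 (a b : d → ℝ) (N : d → d → ℝ) :
    ∑ i, a i * ∑ m, b m * N m i = ∑ m, b m * ∑ i, a i * N m i := by
  simp_rw [Finset.mul_sum]
  rw [Finset.sum_comm]
  exact Finset.sum_congr rfl fun m _ => Finset.sum_congr rfl fun i _ => by ring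

/-- `uᵢX = 0 ∀ i`, `|u| = 1` ⇒ `X = 0`. [bookkeeping] -/
theorem eq_zero_of_axis_mul {u : d → ℝ} (hu1 : ∑ i, u i ^ 2 = 1) {X : ℝ}
    (h : ∀ i, u i * X = 0) : X = 0 := by
  calc X = (∑ i, u i ^ 2) * X := by rw [hu1, one_mul]
    _ = ∑ i, u i * (u i * X) := by
        rw [Finset.sum_mul]; exact Finset.sum_congr rfl fun i _ => by ring
    _ = 0 := Finset.sum_eq_zero fun i _ => by rw [h i, mul_zero]

/-- `Yᵢuⱼ + uᵢYⱼ = 0 ∀ i j`, `|u| = 1` ⇒ `Y = 0`. [bookkeeping] -/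
theorem eq_zero_of_symm_axis {u : d → ℝ} (hu1 : ∑ i, u i ^ 2 = 1) {Y : d → ℝ}
    (h : ∀ i j, Y i * u j + u i * Y j = 0) (i : d) : Y i = 0 := by
  have hi : ∀ i, Y i + u i * ∑ j, u j * Y j = 0 := fun i => by
    have h0 : ∑ j, u j * (Y i * u j + u i * Y j) = 0 :=
      Finset.sum_eq_zero fun j _ => by rw [h i j, mul_zero]
    have hs : ∀ j, u j * (Y i * u j + u i * Y j) = Y i * u j ^ 2 + u i * (u j * Y j) :=
      fun j => by ring
    simp only [hs, Finset.sum_add_distrib, ← Finset.mul_sum, hu1, mul_one] at h0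
    exact h0
  have hS : (∑ j, u j ^ 2) * ∑ j, u j * Y j = -∑ j, u j * Y j := by
    rw [Finset.sum_mul, ← Finset.sum_neg_distrib]
    exact Finset.sum_congr rfl fun j _ => by linear_combination (u j) * hi j
  rw [hu1, one_mul] at hS
  linear_combination hi i - (u i / 2) * hS

/-- (D1) + `∑ₖ K_k c_k = 0` ⇒ `u·w = 0`, `w_l := ∑ₘ K_m D_{m,l}`. [ours] -/
theorem acc_dot_axis (u K : d → ℝ) (c D : d → d → ℝ) (hKc : ∀ i, ∑ k, K k * c k i = 0)
    (hd1 : ∀ m, (∑ l, u l * D m l) + ∑ l, K l * c m l = 0) :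
    ∑ l, u l * ∑ m, K m * D m l = 0 := by
  have h2 : ∀ m, ∑ l, u l * D m l = -∑ l, K l * c m l := fun m => by linarith [hd1 m]
  rw [sum_swap3]
  simp_rw [h2, mul_neg, Finset.sum_neg_distrib, neg_eq_zero]
  rw [← sum_swap3]
  exact Finset.sum_eq_zero fun l _ => by rw [hKc l, mul_zero]

/-- (D2) ⇒ `∑ₗ c_{l,i} w_l = −E_i`, `E_i := ∑ₘ K_m N_{m,i}`. [ours] -/
theorem acc_contract (K : d → ℝ) (c D N : d → d → ℝ)
    (hd2 : ∀ m i, (∑ k, D m k * c k i) + N m i = 0) (i : d) :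
    ∑ l, c l i * ∑ m, K m * D m l = -∑ m, K m * N m i := by
  have h2 : ∀ m, ∑ l, c l i * D m l = -N m i := fun m => by
    rw [Finset.sum_congr rfl fun l _ => mul_comm (c l i) (D m l)]; linarith [hd2 m i]
  rw [sum_swap3]
  simp_rw [h2, mul_neg, Finset.sum_neg_distrib]

/-- (D2) + `u·c_k = 0` ⇒ `u·N_m = 0`. [ours] -/
theorem acc_N_axis (u : d → ℝ) (c D N : d → d → ℝ) (huc : ∀ k, ∑ i, u i * c k i = 0)
    (hd2 : ∀ m i, (∑ k, D m k * c k i) + N m i = 0) (m : d) : ∑ i, u i * N m i = 0 := by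
  have h2 : ∀ i, N m i = -∑ k, D m k * c k i := fun i => by linarith [hd2 m i]
  simp_rw [h2, mul_neg, Finset.sum_neg_distrib, neg_eq_zero]
  rw [sum_swap3]
  exact Finset.sum_eq_zero fun k _ => by rw [huc k, mul_zero]

/-- Twist-free at the point + `u·K = 0` + `∑ₖ K_k c_k = 0` ⇒ `K·c_k = u_k (K·a)`,
`a_l := ∑ⱼ c_{j,l}uⱼ`. [ours] -/
theorem acc_cK (u K : d → ℝ) (c : d → d → ℝ) (huK : ∑ j, u j * K j = 0)
    (hKc : ∀ i, ∑ k, K k * c k i = 0)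
    (htw : ∀ l k, c k l - (∑ j, c j l * u j) * u k = c l k - (∑ j, c j k * u j) * u l) (k : d) :
    ∑ i, K i * c k i = u k * ∑ l, K l * ∑ j, c j l * u j := by
  have h : ∀ i, K i * c k i = K i * c i k - (∑ j, c j k * u j) * (u i * K i)
      + u k * (K i * ∑ j, c j i * u j) := fun i => by linear_combination (K i) * htw i k
  rw [Finset.sum_congr rfl fun i _ => h i, Finset.sum_add_distrib, Finset.sum_sub_distrib,
    ← Finset.mul_sum, ← Finset.mul_sum, hKc k, huK]
  ring

/-- (D1) + (D2) + `K·c_k = u_k (K·a)` ⇒ `K·N_m = u_m (K·a)²`. [ours] -/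
theorem acc_NK (u K : d → ℝ) (c D N : d → d → ℝ) (aK : ℝ)
    (hcK : ∀ k, ∑ i, K i * c k i = u k * aK)
    (hd1 : ∀ m, (∑ l, u l * D m l) + ∑ l, K l * c m l = 0)
    (hd2 : ∀ m i, (∑ k, D m k * c k i) + N m i = 0) (m : d) :
    ∑ i, K i * N m i = u m * aK ^ 2 := by
  have h2 : ∀ i, N m i = -∑ k, D m k * c k i := fun i => by linarith [hd2 m i]
  have h3 : ∑ k, D m k * u k = -(u m * aK) := by
    rw [← hcK m, Finset.sum_congr rfl fun k _ => mul_comm (D m k) (u k)]; linarith [hd1 m]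
  simp_rw [h2, mul_neg, Finset.sum_neg_distrib]
  rw [sum_swap3]
  simp_rw [hcK]
  rw [show ∑ k, D m k * (u k * aK) = (∑ k, D m k * u k) * aK from by
    rw [Finset.sum_mul]; exact Finset.sum_congr rfl fun k _ => by ring, h3]
  ring

end Algebra

/-! ## 2. `Fin 3`: the axial identity and the reciprocal basis `{u, K, u × K}` -/

/-- **`Fin 3` finale**: `E ⊥ u`, `E ⊥ K` and (D3) give `E ⊥ u × K`, hence `|K|² E = 0` — two
polynomial certificates (the axial identity `N(K,u×K) − N(u×K,K) = |K|²·(u·ax N) − (u·K)·(K·ax N)`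
and the reciprocal-basis expansion in `{u, K, u × K}`). [ours] -/
theorem fin3_acc_zero (u K : Fin 3 → ℝ) (N : Fin 3 → Fin 3 → ℝ) (aK : ℝ)
    (hu1 : ∑ i, u i ^ 2 = 1) (huK : ∑ j, u j * K j = 0) (hNu : ∀ m, ∑ i, u i * N m i = 0)
    (hNK : ∀ m, ∑ i, K i * N m i = u m * aK ^ 2)
    (hN3 : u 0 * (N 1 2 - N 2 1) + u 1 * (N 2 0 - N 0 2) + u 2 * (N 0 1 - N 1 0) = 0)
    (i : Fin 3) : (∑ k, K k ^ 2) * ∑ m, K m * N m i = 0 := by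
  have hEu : ∑ i, u i * ∑ m, K m * N m i = 0 := by
    rw [sum_swap3]; exact Finset.sum_eq_zero fun m _ => by rw [hNu m, mul_zero]
  have hEK : ∑ i, K i * ∑ m, K m * N m i = 0 := by
    rw [sum_swap3]; simp_rw [hNK]
    rw [show ∑ m, K m * (u m * aK ^ 2) = aK ^ 2 * ∑ j, u j * K j from by
      rw [Finset.mul_sum]; exact Finset.sum_congr rfl fun m _ => by ring, huK, mul_zero]
  have hNK0 := hNK 0
  have hNK1 := hNK 1
  have hNK2 := hNK 2
  simp only [Fin.sum_univ_three] at hu1 huK hEu hEK hNK0 hNK1 hNK2 ⊢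
  have hET : (u 1 * K 2 - u 2 * K 1) * (K 0 * N 0 0 + K 1 * N 1 0 + K 2 * N 2 0)
      + (u 2 * K 0 - u 0 * K 2) * (K 0 * N 0 1 + K 1 * N 1 1 + K 2 * N 2 1)
      + (u 0 * K 1 - u 1 * K 0) * (K 0 * N 0 2 + K 1 * N 1 2 + K 2 * N 2 2) = 0 := by
    linear_combination (u 1 * K 2 - u 2 * K 1) * hNK0 + (u 2 * K 0 - u 0 * K 2) * hNK1
      + (u 0 * K 1 - u 1 * K 0) * hNK2 + (K 0 ^ 2 + K 1 ^ 2 + K 2 ^ 2) * hN3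
      - (K 0 * (N 1 2 - N 2 1) + K 1 * (N 2 0 - N 0 2) + K 2 * (N 0 1 - N 1 0)) * huK
  fin_cases i <;> simp only [Fin.reduceFinMk, Fin.isValue]
  · linear_combination ((K 0 ^ 2 + K 1 ^ 2 + K 2 ^ 2) * u 0
        - (u 0 * K 0 + u 1 * K 1 + u 2 * K 2) * K 0) * hEu
      + ((u 0 ^ 2 + u 1 ^ 2 + u 2 ^ 2) * K 0 - (u 0 * K 0 + u 1 * K 1 + u 2 * K 2) * u 0) * hEK
      + (u 1 * K 2 - u 2 * K 1) * hET
      - ((K 0 ^ 2 + K 1 ^ 2 + K 2 ^ 2) * (K 0 * N 0 0 + K 1 * N 1 0 + K 2 * N 2 0)) * hu1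
      + ((u 0 * K 0 + u 1 * K 1 + u 2 * K 2) * (K 0 * N 0 0 + K 1 * N 1 0 + K 2 * N 2 0)) * huK
  · linear_combination ((K 0 ^ 2 + K 1 ^ 2 + K 2 ^ 2) * u 1
        - (u 0 * K 0 + u 1 * K 1 + u 2 * K 2) * K 1) * hEu
      + ((u 0 ^ 2 + u 1 ^ 2 + u 2 ^ 2) * K 1 - (u 0 * K 0 + u 1 * K 1 + u 2 * K 2) * u 1) * hEK
      + (u 2 * K 0 - u 0 * K 2) * hET
      - ((K 0 ^ 2 + K 1 ^ 2 + K 2 ^ 2) * (K 0 * N 0 1 + K 1 * N 1 1 + K 2 * N 2 1)) * hu1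
      + ((u 0 * K 0 + u 1 * K 1 + u 2 * K 2) * (K 0 * N 0 1 + K 1 * N 1 1 + K 2 * N 2 1)) * huK
  · linear_combination ((K 0 ^ 2 + K 1 ^ 2 + K 2 ^ 2) * u 2
        - (u 0 * K 0 + u 1 * K 1 + u 2 * K 2) * K 2) * hEu
      + ((u 0 ^ 2 + u 1 ^ 2 + u 2 ^ 2) * K 2 - (u 0 * K 0 + u 1 * K 1 + u 2 * K 2) * u 2) * hEK
      + (u 0 * K 1 - u 1 * K 0) * hET
      - ((K 0 ^ 2 + K 1 ^ 2 + K 2 ^ 2) * (K 0 * N 0 2 + K 1 * N 1 2 + K 2 * N 2 2)) * hu1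
      + ((u 0 * K 0 + u 1 * K 1 + u 2 * K 2) * (K 0 * N 0 2 + K 1 * N 1 2 + K 2 * N 2 2)) * huK

/-- **THE ACCELERATION IS A RULING DIRECTION (algebraic form, `Fin 3`)**: from `|u| = 1`,
`u·K = 0`, `∑ₖ K_k c_k = 0`, `u·c_k = 0`, twist-freeness, (D1), (D2), (D3): `u·w = 0` and
`∑ₗ c_{l,i} w_l = 0` for `w_l := ∑ₘ K_m D_{m,l}`. [ours] -/
theorem acc_is_ruling (u K : Fin 3 → ℝ) (c D N : Fin 3 → Fin 3 → ℝ) (hu1 : ∑ i, u i ^ 2 = 1)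
    (huK : ∑ j, u j * K j = 0) (hKc : ∀ i, ∑ k, K k * c k i = 0)
    (huc : ∀ k, ∑ i, u i * c k i = 0)
    (htw : ∀ l k, c k l - (∑ j, c j l * u j) * u k = c l k - (∑ j, c j k * u j) * u l)
    (hd1 : ∀ m, (∑ l, u l * D m l) + ∑ l, K l * c m l = 0)
    (hd2 : ∀ m i, (∑ k, D m k * c k i) + N m i = 0)
    (hN3 : u 0 * (N 1 2 - N 2 1) + u 1 * (N 2 0 - N 0 2) + u 2 * (N 0 1 - N 1 0) = 0) :
    (∑ l, u l * ∑ m, K m * D m l = 0) ∧ ∀ i, ∑ l, c l i * ∑ m, K m * D m l = 0 := by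
  refine ⟨acc_dot_axis u K c D hKc hd1, fun i => ?_⟩
  rw [acc_contract K c D N hd2 i, neg_eq_zero]
  by_cases hK0 : ∑ k, K k ^ 2 = 0
  · have hk : ∀ k, K k = 0 := fun k =>
      (pow_eq_zero_iff two_ne_zero).mp
        ((Finset.sum_eq_zero_iff_of_nonneg fun k _ => sq_nonneg (K k)).mp hK0 k
          (Finset.mem_univ k))
    simp [hk]
  · have hNK := acc_NK u K c D N _ (acc_cK u K c huK hKc htw) hd1 hd2
    exact (mul_eq_zero.mp (fin3_acc_zero u K N _ hu1 huK (acc_N_axis u c D N huc hd2) hNK hN3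
      i)).resolve_left hK0

end TopEig.Ruling

end Summit.NavierStokesRegularity.FunctionalMining

end
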